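import Summits.ResolutionOfSingularities.ResolutionOfSingularities.Theorems.FrobeniusLadderFRationalResolutionTowerStep
import Mathlib.Algebra.MonoidAlgebra.Basic
import Mathlib.RingTheory.RegularLocalRing.Polynomial
import HarnessLib

/-!
# Toric surface programme: the base `TA[r, 0] = k[ℕ²]` is a regular ring

Support file for crux stmt-ResolutionOfSingularities-15317
(`FrobeniusLadder.FRationalResolution`), line `redirect`, lead c4 (toric surface programme for
rung 4′: all affine toric surfaces `U(r,a) = Spec k[{m ∈ ℤ² : 0 ≤ m₂, a m₂ ≤ r m₁}]` over every
field are resolved by the Hirzebruch–Jung tower of two-chart monomial blow-ups). This file proves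
the base case `P(r, 0)` of the tower, which is also the regular chart of every step: for `1 ≤ r`
the lattice points of the cone `σS[r, 0] = {0 ≤ m₂, 0·m₂ ≤ r m₁}` are exactly the positive
quadrant `{0 ≤ m₁, 0 ≤ m₂}` (`toricBase_mem_iff`), so the monomial algebra `TA[r, 0] ⊆ k[ℤ²]` is
the range of the lattice embedding `k[X₀, X₁] = k[ℕ^{Fin 2}] → k[ℤ²]`, `χᵈ ↦ χ^{(d 0, d 1)}`
(`AddMonoidAlgebra.mapDomainAlgHom` of the exponent map `d ↦ (d 0, d 1)`, injective by
`AddMonoidAlgebra.mapDomain_injective`; `toricBase_range_eq`), and the regularity of the polynomial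
ring `MvPolynomial (Fin 2) k` (Mathlib `MvPolynomial.isRegularRing_of_isRegularRing`, a field being
regular) is transported along `AlgEquiv.ofInjective` and `Subalgebra.equivOfEq`
(`IsRegularRing.of_ringEquiv`): `stub_toric_base_isRegularRing`.

All folklore (Cox–Little–Schenck 2011, Ex. 1.2.21 and §10.1; Fulton 1993, §2.1); no published
fact is used and no definition is introduced (the exponent map is an inline term).
-/

set_option linter.dupNamespace false

noncomputable section

namespace Summit.ResolutionOfSingularities.ResolutionOfSingularities.Theorems.FRationalResolution

open CategoryTheory AlgebraicGeometry TopologicalSpace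
open Literature.AlgebraicGeometry.Resolution

section Toric

variable (k : Type) [Field k]

/-- The Laurent polynomial ring `k[ℤ²]` (coordinate ring of the 2-torus). -/
local notation3 "Lk" => AddMonoidAlgebra k (ℤ × ℤ)

/-- The lattice points of the dual cone `σ∨ = {m₂ ≥ 0, a m₂ ≤ r m₁}` of `σ = cone((0,1),(r,-a))`. -/
local notation3 "σS[" r ", " a "]" =>
  {m : ℤ × ℤ | 0 ≤ m.2 ∧ ((a : ℕ) : ℤ) * m.2 ≤ ((r : ℕ) : ℤ) * m.1}

/-- The toric surface algebra `k[σ∨ ∩ ℤ²] ⊆ k[ℤ²]`. -/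
local notation3 "TA[" r ", " a "]" =>
  Algebra.adjoin k ((fun m : ℤ × ℤ => AddMonoidAlgebra.single m (1 : k)) '' σS[r, a])

/-- For `1 ≤ r` the lattice points of the cone `σS[r, 0] = {0 ≤ m₂, 0·m₂ ≤ r·m₁}` are exactly the
positive quadrant `{0 ≤ m₁, 0 ≤ m₂}` of `ℤ²`. -/
theorem toricBase_mem_iff (r : ℕ) (hr : 1 ≤ r) (m : ℤ × ℤ) :
    m ∈ σS[r, 0] ↔ 0 ≤ m.1 ∧ 0 ≤ m.2 := by
  have hr' : (0 : ℤ) < (r : ℤ) := by exact_mod_cast hr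
  simp only [Set.mem_setOf_eq, Nat.cast_zero, zero_mul]
  constructor
  · rintro ⟨h2, h1⟩
    exact ⟨nonneg_of_mul_nonneg_right h1 hr', h2⟩
  · rintro ⟨h1, h2⟩
    exact ⟨h2, mul_nonneg hr'.le h1⟩

/-- For `1 ≤ r`, the range of a `k`-algebra map `φ : k[X₀, X₁] → k[ℤ²]` sending each
monomial `c·χᵈ` (`d : Fin 2 →₀ ℕ`) to the Laurent monomial `c·χ^{(d 0, d 1)}` is the toric
algebra `TA[r, 0] = k[ℕ²] ⊆ k[ℤ²]`: every `φ (c·χᵈ) = c • χ^{(d 0, d 1)}` is a scalar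
multiple of a generator, and every generator `χᵐ`, `0 ≤ m₁, m₂`, is `φ (X₀ ^ m₁ X₁ ^ m₂)`. -/
theorem toricBase_range_eq (r : ℕ) (hr : 1 ≤ r) (φ : MvPolynomial (Fin 2) k →ₐ[k] Lk)
    (hφ : ∀ (d : Fin 2 →₀ ℕ) (c : k), φ (AddMonoidAlgebra.single d c) =
      AddMonoidAlgebra.single (((d 0 : ℕ) : ℤ), ((d 1 : ℕ) : ℤ)) c) :
    φ.range = TA[r, 0] := by
  apply le_antisymm
  · intro x hx
    obtain ⟨p, rfl⟩ := (AlgHom.mem_range φ).mp hx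
    induction p using AddMonoidAlgebra.induction_linear with
    | zero => rw [map_zero]; exact zero_mem _
    | add x y hx' hy' => rw [map_add]; exact add_mem (hx' ⟨x, rfl⟩) (hy' ⟨y, rfl⟩)
    | single d c =>
      rw [hφ, ← mul_one c, ← AddMonoidAlgebra.smul_single']
      have hmem :
          AddMonoidAlgebra.single (((d 0 : ℕ) : ℤ), ((d 1 : ℕ) : ℤ)) (1 : k) ∈ TA[r, 0] :=
        Algebra.subset_adjoin (Set.mem_image_of_mem _
          ((toricBase_mem_iff r hr _).mpr ⟨Int.natCast_nonneg _, Int.natCast_nonneg _⟩))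
      exact Subalgebra.smul_mem _ hmem c
  · refine Algebra.adjoin_le ?_
    rintro _ ⟨m, hm, rfl⟩
    obtain ⟨h1, h2⟩ := (toricBase_mem_iff r hr m).mp hm
    refine (AlgHom.mem_range φ).mpr
      ⟨AddMonoidAlgebra.single (Finsupp.single 0 m.1.toNat + Finsupp.single 1 m.2.toNat) 1, ?_⟩
    rw [hφ]
    congr 1
    ext
    · simp [Int.toNat_of_nonneg h1]
    · simp [Int.toNat_of_nonneg h2]

/-- **Base of the toric tower** (registered stub `stub_toric_base_isRegularRing`, crux
stmt-ResolutionOfSingularities-15317, line `redirect`): for `1 ≤ r` the toric surface algebra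
`TA[r, 0] = k[{0 ≤ m₂, 0 ≤ r m₁}] = k[ℕ²] ⊆ k[ℤ²]` is a regular ring. It is the range of the
lattice embedding `k[X₀, X₁] = k[ℕ^{Fin 2}] ↪ k[ℤ²]`, `χᵈ ↦ χ^{(d 0, d 1)}`
(`AddMonoidAlgebra.mapDomainAlgHom`, injective by `AddMonoidAlgebra.mapDomain_injective`, range
`toricBase_range_eq`), so it is `k`-isomorphic to the polynomial ring `MvPolynomial (Fin 2) k`
(`AlgEquiv.ofInjective`, `Subalgebra.equivOfEq`), which is regular (Mathlib
`MvPolynomial.isRegularRing_of_isRegularRing`); conclude with `IsRegularRing.of_ringEquiv`.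
[folklore; Cox–Little–Schenck 2011, Ex. 1.2.21] -/
theorem stub_toric_base_isRegularRing (r : ℕ) (hr : 1 ≤ r) :
    IsRegularRing ↥TA[r, 0] := by
  -- the exponent embedding `ℕ^{Fin 2} ↪ ℤ²`, `d ↦ (d 0, d 1)`
  let ι : (Fin 2 →₀ ℕ) →+ ℤ × ℤ :=
    AddMonoidHom.prod ((Nat.castAddMonoidHom ℤ).comp (Finsupp.applyAddHom 0))
      ((Nat.castAddMonoidHom ℤ).comp (Finsupp.applyAddHom 1))
  have hι : ∀ d, ι d = (((d 0 : ℕ) : ℤ), ((d 1 : ℕ) : ℤ)) := fun d => rfl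
  have hιinj : Function.Injective ι := by
    intro d d' h
    rw [hι, hι, Prod.mk.injEq, Nat.cast_inj, Nat.cast_inj] at h
    ext i
    fin_cases i
    exacts [h.1, h.2]
  -- the induced `k`-algebra map `k[X₀, X₁] → k[ℤ²]`, injective with range `TA[r, 0]`
  let φ : MvPolynomial (Fin 2) k →ₐ[k] Lk := AddMonoidAlgebra.mapDomainAlgHom k k ι
  have hφinj : Function.Injective φ := fun p q hpq =>
    AddMonoidAlgebra.mapDomain_injective hιinj
      (by rwa [AddMonoidAlgebra.mapDomainAlgHom_apply,
        AddMonoidAlgebra.mapDomainAlgHom_apply] at hpq)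
  have hrange : φ.range = TA[r, 0] :=
    toricBase_range_eq k r hr φ fun d c => by
      rw [AddMonoidAlgebra.mapDomainAlgHom_apply, AddMonoidAlgebra.mapDomain_single, hι]
  -- transport the regularity of `k[X₀, X₁]`
  exact IsRegularRing.of_ringEquiv
    ((AlgEquiv.ofInjective φ hφinj).trans (Subalgebra.equivOfEq _ _ hrange)).toRingEquiv

end Toric

end Summit.ResolutionOfSingularities.ResolutionOfSingularities.Theorems.FRationalResolution

end
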